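import Summits.Ventures.YMGap.RobustBall.MassGapOfDoor
import Literature.Probability.LatticeModels.DobrushinComparisonBoundary
import HarnessLib

/-!
# Venture YMGap, track ROBUST-BALL — ONE STATE AT A RATE, step 1: exponential insensitivity to the boundary
# condition inside a single-link Dobrushin door (generic specification lemma + the tier-1 `ℤ^d` carrier)

HONEST FRAMING. WHAT THIS IS: a venture file (cell `pub-ymgap`, track Y2 ROBUST-BALL, seat ds-3, theorems only). The
boundary-limit theorems of `BoundaryLimitDLR.lean` / `OneStateBoundary.lean` say that in the uniqueness regime the
finite-volume Gibbs distributions `γ^W_Λ(· | η)` with ARBITRARY boundary fields converge to the one DLR state, with NO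
rate. This file supplies the RATE, inside any single-link Dobrushin door in the Vasserstein form:

* GENERIC (`BoundaryDecay.abs_integral_sub_integral_kernel_le`, any specification `γ` on `V → S` with
  `IsKRContraction γ r nbr C`, weight `0 ≤ r ≤ R`, row sums `≤ c ≤ 1` on `Λ`): for every Gibbs measure `μ`, every finite
  volume `Λ`, every boundary condition `η` and every profile `ℓ : V → ℕ` vanishing off `Λ` with `ℓ x ≤ ℓ y + 1` along
  `nbr`, a bounded measurable local `f` (dependence set `Δ`, Lipschitz bound `δ`) satisfies
  `|∫ f dμ − ∫ f dγ_Λ(· | η)| ≤ R Σ_{y ∈ Δ} c^{ℓ y} δ_y` — Föllmer's comparison (2.8)/(2.10) in the profile form with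
  USABLE SET `Λ`: the kernel `γ_Λ(· | η)` is an invariant state of the one-site operators `γ_x`, `x ∈ Λ` (consistency,
  tree `DobrushinMetric.isInvariantState_kernel`), the Gibbs measure is invariant everywhere, and the tree's
  `DustingData.abs_sub_le_sum_pow_profile` does the rest; the same for TWO boundary conditions
  (`BoundaryDecay.abs_integral_kernel_sub_integral_kernel_le`). Georgii 2011, Remark 8.26 / (8.29)-type statement.
* CARRIER (rb-p1's `perturbedYM`, `SU(N)`, every `d`): given ANY `IsKRContraction (perturbedYM (fundamentalRep (Fin N))
  (N β) W supp) suFrobDist (perturbedNbr supp) C` with row sums `≤ ρ < 1` and a member of `ℓ^∞`-range `R` — exactly the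
  hypotheses of `MassGapOfDoor.perturbed_covariance_decay_of_isKRContraction` — EVERY DLR state `μ`, EVERY finite link
  volume `Λ`, EVERY boundary field `η` and every Lipschitz cylinder `F` (constant `K`, links `Δ`) whose links lie at
  base-point `ℓ^∞`-distance `≥ D` from every link outside `Λ` satisfy
  `|∫ F dγ^W_Λ(· | η) − ∫ F dμ| ≤ 2√N · K · #Δ · max(ρ,½)^{⌊D / max(1,R)⌋}`
  `≤ 2√N · K · #Δ · e^{κ} e^{−(κ/max(1,R)) D}`, `κ = −log max(ρ, ½)` (`abs_boundary_sub_integral_le_of_isKRContraction`,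
  `…_exp`): the SAME rate as the clustering rows of `UniformMassGapKR.lean`; two boundary fields:
  `abs_boundary_sub_boundary_le_of_isKRContraction`. The companion file `BoundaryDecayBall.lean` feeds the doors:
  UNIFORMLY on the ball `MemBallZd ε₀ ε₁ R` through rb-p1's pair door, hypothesis-free for `SU(2)`, every `N` through
  Bakry–Émery, and the named cells.
WHAT THIS IS NOT: the rate is the Dobrushin-comparison LOWER bound on the inverse penetration depth of the boundary
(it vanishes linearly at the door's threshold and is divided by the range); single-link doors only (not the vertex-star
window); strong-coupling LATTICE statements, nothing about the continuum limit or the Clay Millennium problem.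

References: H. Föllmer, LNM 1362 (1988), Ch. I, (2.8), (2.10), Remark (2.17); H.-O. Georgii, *Gibbs Measures and Phase
Transitions* (2011), Thm. 8.20, Remark 8.26; R. L. Dobrushin, Theory Probab. Appl. 15 (1970), Thm. 3; the tree's
`DobrushinComparisonBoundary.lean`, `DobrushinComparisonMetric.lean`, `MassGapOfDoor.lean`, `UniformMassGapKR.lean`.
-/

noncomputable section

open MeasureTheory Filter Function ProbabilityTheory Real
open scoped NNReal
open Literature.Probability.LatticeModels
open Literature.Probability.LatticeModels.DobrushinMetric
open Literature.MathematicalPhysics.QuantumLattice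
open Literature.MathematicalPhysics.QuantumFieldTheory hiding ZdEdge

namespace Summit.Ventures.YMGap.RobustBall

/-! ### Generic: a finite-volume kernel against a Gibbs measure / another boundary condition, profile form -/

namespace BoundaryDecay

variable {V S : Type*} [MeasurableSpace S] {γ : Specification V S} {r : S → S → ℝ}
  {nbr : V → Finset V} {C : V → V → ℝ}

/-- **Two boundary conditions, profile form** (Föllmer 1988, Ch. I, (2.8) with the conditional specification (2.10);
Georgii 2011, Remark 8.26): under Dobrushin's condition in the Vasserstein form with weight `0 ≤ r ≤ R` and row sums
`≤ c ≤ 1` on the finite volume `Λ`, for every profile `ℓ : V → ℕ` vanishing off `Λ` with `ℓ x ≤ ℓ y + 1` for `x ∈ Λ`,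
`y ∈ nbr x`, every two boundary conditions `η, η'` and every bounded measurable `f` depending on `Δ` with Lipschitz
bound `δ`: `|∫ f dγ_Λ(·|η) − ∫ f dγ_Λ(·|η')| ≤ R Σ_{y ∈ Δ} c^{ℓ y} δ_y` — both kernels are invariant states of the
one-site operators usable on `Λ` (tree `isInvariantState_kernel`), then `DustingData.abs_sub_le_sum_pow_profile`.
[folklore] -/
theorem abs_integral_kernel_sub_integral_kernel_le [DecidableEq V] (hγ : IsSpecification γ)
    (hC : IsKRContraction γ r nbr C) {R : ℝ} (hr0 : ∀ a b, 0 ≤ r a b) (hrR : ∀ a b, r a b ≤ R)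
    (hR : 0 ≤ R) {c : ℝ} (hc0 : 0 ≤ c) (hc1 : c ≤ 1) (Λ : Finset V)
    (hrow : ∀ x ∈ Λ, ∑ y ∈ nbr x, C x y ≤ c) (η η' : V → S) (ℓ : V → ℕ) (hℓ0 : ∀ y ∉ Λ, ℓ y = 0)
    (hℓ : ∀ x ∈ Λ, ∀ y ∈ nbr x, ℓ x ≤ ℓ y + 1) {f : (V → S) → ℝ} (hfm : Measurable f) {Δ : Finset V}
    (hfdep : DependsOn f (↑Δ : Set V)) {M : ℝ} (hM : ∀ σ, |f σ| ≤ M) {δ : V → ℝ} (hδ : IsLipBound r f δ) :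
    |(∫ σ, f σ ∂(γ Λ η)) - ∫ σ, f σ ∂(γ Λ η')| ≤ R * ∑ y ∈ Δ, c ^ ℓ y * δ y := by
  have h₁ := isInvariantState_kernel hγ hC hr0 hrR hR Λ η
  have h₂ := isInvariantState_kernel hγ hC hr0 hrR hR Λ η'
  have hrowD : ∀ x ∈ (krDustingData hγ hC hr0 hrR hR (↑Λ : Set V)).W,
      ∑ y ∈ (krDustingData hγ hC hr0 hrR hR (↑Λ : Set V)).nbr x,
        (krDustingData hγ hC hr0 hrR hR (↑Λ : Set V)).C x y ≤ c := fun x hx =>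
    (sum_krDustingData_C hγ hC hr0 hrR hR (↑Λ : Set V) x).le.trans (hrow x (Finset.mem_coe.1 hx))
  have hℓ0' : ∀ y ∉ (krDustingData hγ hC hr0 hrR hR (↑Λ : Set V)).W, ℓ y = 0 := fun y hy =>
    hℓ0 y fun h => hy (Finset.mem_coe.2 h)
  have hℓ' : ∀ x ∈ (krDustingData hγ hC hr0 hrR hR (↑Λ : Set V)).W,
      ∀ y ∈ (krDustingData hγ hC hr0 hrR hR (↑Λ : Set V)).nbr x, ℓ x ≤ ℓ y + 1 := fun x hx y hy =>
    hℓ x (Finset.mem_coe.1 hx) y hy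
  have h := DustingData.abs_sub_le_sum_pow_profile h₁ h₂ hc0 hc1 hrowD ℓ hℓ0' hℓ' (f := f) (Δ := Δ)
    ⟨hfm, hfdep, M, hM⟩ (hδ.restrict hfdep) (fun y hy => if_neg hy)
  refine h.trans (le_of_eq ?_)
  change R * _ = R * _
  refine congrArg (R * ·) (Finset.sum_congr rfl fun y hy => ?_)
  rw [if_pos hy]

/-- **A Gibbs measure against a finite-volume kernel with ANY boundary condition, profile form** (Föllmer 1988, Ch. I,
(2.8)/(2.10); Georgii 2011, Thm. 8.20 / Remark 8.26): under Dobrushin's condition in the Vasserstein form with weight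
`0 ≤ r ≤ R` and row sums `≤ c ≤ 1` on `Λ`, for every Gibbs measure `μ` of `γ`, every boundary condition `η`, every
profile `ℓ : V → ℕ` vanishing off `Λ` with `ℓ x ≤ ℓ y + 1` for `x ∈ Λ`, `y ∈ nbr x`, and every bounded measurable `f`
depending on `Δ` with Lipschitz bound `δ`: `|∫ f dμ − ∫ f dγ_Λ(·|η)| ≤ R Σ_{y ∈ Δ} c^{ℓ y} δ_y`. The Gibbs measure is an
invariant state of every one-site operator (DLR), the kernel of those at `x ∈ Λ` (consistency). [folklore] -/
theorem abs_integral_sub_integral_kernel_le [DecidableEq V] (hγ : IsSpecification γ)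
    (hC : IsKRContraction γ r nbr C) {R : ℝ} (hr0 : ∀ a b, 0 ≤ r a b) (hrR : ∀ a b, r a b ≤ R)
    (hR : 0 ≤ R) {c : ℝ} (hc0 : 0 ≤ c) (hc1 : c ≤ 1) (Λ : Finset V)
    (hrow : ∀ x ∈ Λ, ∑ y ∈ nbr x, C x y ≤ c) {μ : Measure (V → S)} (hμ : IsGibbsMeasure γ μ)
    (η : V → S) (ℓ : V → ℕ) (hℓ0 : ∀ y ∉ Λ, ℓ y = 0) (hℓ : ∀ x ∈ Λ, ∀ y ∈ nbr x, ℓ x ≤ ℓ y + 1)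
    {f : (V → S) → ℝ} (hfm : Measurable f) {Δ : Finset V} (hfdep : DependsOn f (↑Δ : Set V))
    {M : ℝ} (hM : ∀ σ, |f σ| ≤ M) {δ : V → ℝ} (hδ : IsLipBound r f δ) :
    |(∫ σ, f σ ∂μ) - ∫ σ, f σ ∂(γ Λ η)| ≤ R * ∑ y ∈ Δ, c ^ ℓ y * δ y := by
  have h₁ := isInvariantState_integral_of_isGibbsMeasure hγ hC hr0 hrR hR (↑Λ : Set V) hμ
  have h₂ := isInvariantState_kernel hγ hC hr0 hrR hR Λ η
  have hrowD : ∀ x ∈ (krDustingData hγ hC hr0 hrR hR (↑Λ : Set V)).W,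
      ∑ y ∈ (krDustingData hγ hC hr0 hrR hR (↑Λ : Set V)).nbr x,
        (krDustingData hγ hC hr0 hrR hR (↑Λ : Set V)).C x y ≤ c := fun x hx =>
    (sum_krDustingData_C hγ hC hr0 hrR hR (↑Λ : Set V) x).le.trans (hrow x (Finset.mem_coe.1 hx))
  have hℓ0' : ∀ y ∉ (krDustingData hγ hC hr0 hrR hR (↑Λ : Set V)).W, ℓ y = 0 := fun y hy =>
    hℓ0 y fun h => hy (Finset.mem_coe.2 h)
  have hℓ' : ∀ x ∈ (krDustingData hγ hC hr0 hrR hR (↑Λ : Set V)).W,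
      ∀ y ∈ (krDustingData hγ hC hr0 hrR hR (↑Λ : Set V)).nbr x, ℓ x ≤ ℓ y + 1 := fun x hx y hy =>
    hℓ x (Finset.mem_coe.1 hx) y hy
  have h := DustingData.abs_sub_le_sum_pow_profile h₁ h₂ hc0 hc1 hrowD ℓ hℓ0' hℓ' (f := f) (Δ := Δ)
    ⟨hfm, hfdep, M, hM⟩ (hδ.restrict hfdep) (fun y hy => if_neg hy)
  refine h.trans (le_of_eq ?_)
  change R * _ = R * _
  refine congrArg (R * ·) (Finset.sum_congr rfl fun y hy => ?_)
  rw [if_pos hy]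

end BoundaryDecay

/-! ### Two elementary lemmas: the integer profile and the geometric-to-exponential conversion -/

/-- `⌊b + 1⌋₊ ≤ ⌊b⌋₊ + 1` for every real `b` (equality for `b ≥ 0`; for `b < 0` the left side is `≤ 1`... in fact `0`
when `b + 1 < 1`). [folklore] -/
theorem natFloor_add_one_le (b : ℝ) : ⌊b + 1⌋₊ ≤ ⌊b⌋₊ + 1 := by
  rcases le_or_gt 0 b with hb | hb
  · rw [Nat.floor_add_one hb]
  · have h : ⌊b + 1⌋₊ = 0 := Nat.floor_eq_zero.2 (by linarith)
    rw [h]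
    exact Nat.zero_le _

/-- **Geometric to exponential**: for `0 < c ≤ 1` and every real `a`, `c^{⌊a⌋₊} ≤ e^{κ} e^{−κ a}` with `κ = −log c`
(`⌊a⌋₊ ≥ a − 1`). [folklore] -/
theorem pow_natFloor_le_exp_mul_exp {c : ℝ} (hc0 : 0 < c) (hc1 : c ≤ 1) (a : ℝ) :
    c ^ ⌊a⌋₊ ≤ exp (-Real.log c) * exp (-(-Real.log c) * a) := by
  have hκ0 : 0 ≤ -Real.log c := neg_nonneg.2 (Real.log_nonpos hc0.le hc1)
  have hfl : a - 1 ≤ (⌊a⌋₊ : ℝ) := by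
    have := Nat.lt_floor_add_one a
    linarith
  rw [← exp_add, ← Real.rpow_natCast, Real.rpow_def_of_pos hc0]
  refine exp_le_exp.2 ?_
  have := mul_le_mul_of_nonneg_left hfl hκ0
  nlinarith

variable {d N : ℕ}

/-- **The depth profile.** If neighbouring links are at base-point distance `≤ R₀` and every link of the nonempty set `Δ`
is at distance `≥ D` from every link outside `Λ`, then `ℓ(y) = ⌊(D − dist(y, Δ)) / R₀⌋₊` vanishes outside `Λ`, is
`1`-Lipschitz along neighbours inside `Λ`, and equals `⌊D / R₀⌋₊` on `Δ`. [folklore] -/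
theorem exists_depthProfile {supp : Finset (ZdEdge d) → Finset (Finset (ZdEdge d))} {R₀ D : ℝ} (hR₀0 : 0 < R₀)
    (hnbr : ∀ x, ∀ y ∈ perturbedNbr supp x, ‖x.1 - y.1‖ ≤ R₀) {Λ Δ : Finset (ZdEdge d)} (hΔ : Δ.Nonempty)
    (hD : ∀ y ∈ Δ, ∀ z, z ∉ Λ → D ≤ ‖y.1 - z.1‖) :
    ∃ ℓ : ZdEdge d → ℕ, (∀ y ∉ Λ, ℓ y = 0) ∧ (∀ x ∈ Λ, ∀ y ∈ perturbedNbr supp x, ℓ x ≤ ℓ y + 1) ∧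
      ∀ y ∈ Δ, ℓ y = ⌊D / R₀⌋₊ := by
  refine ⟨fun y => ⌊(D - linkSetDist Δ y) / R₀⌋₊, fun y hy => ?_, fun x _ y hy => ?_, fun y hy => ?_⟩
  · have hdistD : D ≤ linkSetDist Δ y := by
      unfold linkSetDist
      rw [dif_pos hΔ]
      exact (Finset.le_inf'_iff hΔ _).2 fun y' hy' => by rw [norm_sub_rev]; exact hD y' hy' y hy
    exact Nat.floor_of_nonpos (div_nonpos_of_nonpos_of_nonneg (sub_nonpos.2 hdistD) hR₀0.le)
  · have h0 : linkSetDist Δ y ≤ linkSetDist Δ x + R₀ := by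
      have h := linkSetDist_le_add_norm Δ y x
      rw [norm_sub_rev] at h
      exact h.trans (add_le_add le_rfl (hnbr x y hy))
    have h1 : (D - linkSetDist Δ x) / R₀ ≤ (D - linkSetDist Δ y) / R₀ + 1 := by
      rw [div_add_one hR₀0.ne', div_le_div_iff_of_pos_right hR₀0]
      linarith
    exact (Nat.floor_mono h1).trans (natFloor_add_one_le _)
  · simp only [linkSetDist_eq_zero_of_mem hy, sub_zero]

/-- The range of the neighbourhood `perturbedNbr supp` of a member of `ℓ^∞`-range `R` is `≤ max(1, R)`. [folklore] -/
theorem norm_sub_le_of_mem_perturbedNbr {supp : Finset (ZdEdge d) → Finset (Finset (ZdEdge d))} {R : ℝ}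
    (hR : ∀ e, ∀ X ∈ supp {e}, e ∈ X → ∀ y ∈ X, ‖e.1 - y.1‖ ≤ R) (x : ZdEdge d) {y : ZdEdge d}
    (hy : y ∈ perturbedNbr supp x) : ‖x.1 - y.1‖ ≤ max 1 R := by
  rcases (mem_perturbedNbr_iff.1 hy).2 with hy' | ⟨X, hX, hxX, hyX⟩
  · exact (norm_sub_le_one_of_mem_linkPlaqNbr hy').trans (le_max_left _ _)
  · exact (hR x X hX hxX y hyX).trans (le_max_right _ _)

/-- The sum appearing in the comparison estimate for a Lipschitz cylinder on `Δ` with a profile constant on `Δ`.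
[folklore] -/
theorem sum_pow_mul_ite_eq {Δ : Finset (ZdEdge d)} {c K : ℝ} {ℓ : ZdEdge d → ℕ} {m : ℕ} (hℓΔ : ∀ y ∈ Δ, ℓ y = m) :
    ∑ y ∈ Δ, c ^ ℓ y * (if y ∈ Δ then 1 * K else 0) = Δ.card * (c ^ m * K) := by
  calc ∑ y ∈ Δ, c ^ ℓ y * (if y ∈ Δ then 1 * K else 0) = ∑ y ∈ Δ, c ^ m * K :=
        Finset.sum_congr rfl fun y hy => by rw [if_pos hy, one_mul, hℓΔ y hy]
    _ = Δ.card * (c ^ m * K) := by rw [Finset.sum_const, nsmul_eq_mul]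

/-! ### The carrier: every DLR state vs. every finite-volume Gibbs distribution of the member -/

/-- **EXPONENTIAL INSENSITIVITY TO THE BOUNDARY CONDITION from ANY robust single-link door, geometric form.** Let
`IsKRContraction (perturbedYM (fundamentalRep (Fin N)) (N β) W supp) suFrobDist (perturbedNbr supp) C` have row sums
`≤ ρ < 1` and let the member have `ℓ^∞`-range `R`. Then for EVERY DLR state `μ`, EVERY finite link volume `Λ`, EVERY
boundary field `η`, every Lipschitz cylinder `F` (constant `K`, links `Δ`) and every `D` such that every link of `Δ`
is at base-point `ℓ^∞`-distance `≥ D` from every link outside `Λ`: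
`|∫ F dγ^W_Λ(· | η) − ∫ F dμ| ≤ 2√N · K · #Δ · max(ρ, ½)^{⌊D / max(1, R)⌋₊}` — `BoundaryDecay.abs_integral_sub_integral_kernel_le`
with the depth profile (`exists_depthProfile`) and the Frobenius weight `≤ 2√N`. [folklore] -/
theorem abs_boundary_sub_integral_le_of_isKRContraction {β ρ R : ℝ}
    {W : Potential (ZdEdge d) (Matrix.specialUnitaryGroup (Fin N) ℂ)} (hW : W.IsAdapted)
    (hWb : ∀ X, ∃ C, ∀ U, |W X U| ≤ C)
    {supp : Finset (ZdEdge d) → Finset (Finset (ZdEdge d))} (hsupp : W.IsSupportedBy supp)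
    {C : ZdEdge d → ZdEdge d → ℝ}
    (hKR : IsKRContraction (perturbedYM (d := d) (fundamentalRep (Fin N)) (N * β) W supp) suFrobDist
      (perturbedNbr supp) C)
    (hrow : ∀ x, ∑ y ∈ perturbedNbr supp x, C x y ≤ ρ) (hρ : ρ < 1)
    (hR : ∀ e, ∀ X ∈ supp {e}, e ∈ X → ∀ y ∈ X, ‖e.1 - y.1‖ ≤ R)
    {μ : Measure (LGConfig d (Matrix.specialUnitaryGroup (Fin N) ℂ))}
    (hμ : μ ∈ perturbedGibbsMeasures (d := d) (fundamentalRep (Fin N)) (N * β) W supp)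
    (Λ : Finset (ZdEdge d)) (η : LGConfig d (Matrix.specialUnitaryGroup (Fin N) ℂ))
    {F : LGConfig d (Matrix.specialUnitaryGroup (Fin N) ℂ) → ℝ} {Δ : Finset (ZdEdge d)} {K : ℝ≥0}
    (hF : IsLipschitzCylinder (fundamentalRep (Fin N)) F Δ K) {D : ℝ}
    (hD : ∀ y ∈ Δ, ∀ z, z ∉ Λ → D ≤ ‖y.1 - z.1‖) :
    |(∫ U, F U ∂(perturbedYM (d := d) (fundamentalRep (Fin N)) (N * β) W supp Λ η)) - ∫ U, F U ∂μ| ≤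
      2 * Real.sqrt N * K * Δ.card * (max ρ (1 / 2)) ^ ⌊D / max 1 R⌋₊ := by
  classical
  haveI : SecondCountableTopology (Matrix (Fin N) (Fin N) ℂ) :=
    inferInstanceAs (SecondCountableTopology (Fin N → Fin N → ℂ))
  haveI : SecondCountableTopology (Matrix.specialUnitaryGroup (Fin N) ℂ) :=
    Topology.IsEmbedding.subtypeVal.secondCountableTopology
  have hγ : IsSpecification (perturbedYM (d := d) (fundamentalRep (Fin N)) (N * β) W supp) :=
    isSpecification_perturbedYM _ (continuous_fundamentalRep (Fin N)) _ hW hWb hsupp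
  have hc'0 : 0 < max ρ (1 / 2) := lt_max_of_lt_right (by norm_num)
  have hc'1 : max ρ (1 / 2) < 1 := max_lt hρ (by norm_num)
  have hrow' : ∀ x ∈ Λ, ∑ y ∈ perturbedNbr supp x, C x y ≤ max ρ (1 / 2) := fun x _ =>
    (hrow x).trans (le_max_left _ _)
  have hR₀0 : 0 < max 1 R := zero_lt_one.trans_le (le_max_left _ _)
  have hRsqrt : (0 : ℝ) ≤ 2 * Real.sqrt N := by positivity
  have hμ' : IsGibbsMeasure (perturbedYM (d := d) (fundamentalRep (Fin N)) (N * β) W supp) μ := hμ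
  haveI := hμ'.isProbabilityMeasure
  haveI := hγ.isProbability Λ η
  -- the trivial case `Δ = ∅`: `F` is constant
  rcases Δ.eq_empty_or_nonempty with hΔ | hΔ
  · have hconst : ∀ U, F U = F 1 := fun U => hF.dependsOn (fun x hx => by simp [hΔ] at hx)
    simp only [hconst, integral_const, smul_eq_mul, probReal_univ, one_mul, sub_self, abs_zero, hΔ,
      Finset.card_empty, Nat.cast_zero, mul_zero, zero_mul, le_refl]
  obtain ⟨ℓ, hℓ0, hℓ1, hℓΔ⟩ := exists_depthProfile hR₀0 (fun x y hy => norm_sub_le_of_mem_perturbedNbr hR x hy) hΔ hD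
  have key := BoundaryDecay.abs_integral_sub_integral_kernel_le hγ hKR (fun _ _ => suFrobDist_nonneg _ _)
    suFrobDist_le hRsqrt hc'0.le hc'1.le Λ hrow' hμ' η ℓ hℓ0 hℓ1 hF.measurable hF.dependsOn hF.abs_le
    (hF.isLipBound zero_le_one (fun a b => by rw [one_mul]; exact dist_suEntries_le_suFrobDist a b))
  rw [sum_pow_mul_ite_eq hℓΔ] at key
  rw [abs_sub_comm]
  refine key.trans (le_of_eq ?_)
  ring

/-- **EXPONENTIAL INSENSITIVITY TO THE BOUNDARY CONDITION from ANY robust single-link door, exponential form**: under the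
hypotheses of `abs_boundary_sub_integral_le_of_isKRContraction`,
`|∫ F dγ^W_Λ(· | η) − ∫ F dμ| ≤ 2√N · K · #Δ · e^{κ} · e^{−(κ / max(1,R)) D}`, `κ = −log max(ρ, ½)` — the rate and the
shape of the clustering rows (`UniformMassGapKR.perturbedClustering_of_isKRContraction`). [folklore] -/
theorem abs_boundary_sub_integral_le_of_isKRContraction_exp {β ρ R : ℝ}
    {W : Potential (ZdEdge d) (Matrix.specialUnitaryGroup (Fin N) ℂ)} (hW : W.IsAdapted)
    (hWb : ∀ X, ∃ C, ∀ U, |W X U| ≤ C)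
    {supp : Finset (ZdEdge d) → Finset (Finset (ZdEdge d))} (hsupp : W.IsSupportedBy supp)
    {C : ZdEdge d → ZdEdge d → ℝ}
    (hKR : IsKRContraction (perturbedYM (d := d) (fundamentalRep (Fin N)) (N * β) W supp) suFrobDist
      (perturbedNbr supp) C)
    (hrow : ∀ x, ∑ y ∈ perturbedNbr supp x, C x y ≤ ρ) (hρ : ρ < 1)
    (hR : ∀ e, ∀ X ∈ supp {e}, e ∈ X → ∀ y ∈ X, ‖e.1 - y.1‖ ≤ R)
    {μ : Measure (LGConfig d (Matrix.specialUnitaryGroup (Fin N) ℂ))}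
    (hμ : μ ∈ perturbedGibbsMeasures (d := d) (fundamentalRep (Fin N)) (N * β) W supp)
    (Λ : Finset (ZdEdge d)) (η : LGConfig d (Matrix.specialUnitaryGroup (Fin N) ℂ))
    {F : LGConfig d (Matrix.specialUnitaryGroup (Fin N) ℂ) → ℝ} {Δ : Finset (ZdEdge d)} {K : ℝ≥0}
    (hF : IsLipschitzCylinder (fundamentalRep (Fin N)) F Δ K) {D : ℝ}
    (hD : ∀ y ∈ Δ, ∀ z, z ∉ Λ → D ≤ ‖y.1 - z.1‖) :
    |(∫ U, F U ∂(perturbedYM (d := d) (fundamentalRep (Fin N)) (N * β) W supp Λ η)) - ∫ U, F U ∂μ| ≤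
      2 * Real.sqrt N * K * Δ.card * (exp (-Real.log (max ρ (1 / 2))) *
        exp (-(-Real.log (max ρ (1 / 2)) / max 1 R) * D)) := by
  have hc'0 : 0 < max ρ (1 / 2) := lt_max_of_lt_right (by norm_num)
  have hc'1 : max ρ (1 / 2) < 1 := max_lt hρ (by norm_num)
  have hR₀0 : 0 < max 1 R := zero_lt_one.trans_le (le_max_left _ _)
  have hK : (0 : ℝ) ≤ K := K.2
  have hgeom := pow_natFloor_le_exp_mul_exp hc'0 hc'1.le (D / max 1 R)
  have e : -(-Real.log (max ρ (1 / 2))) * (D / max 1 R) = -(-Real.log (max ρ (1 / 2)) / max 1 R) * D := by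
    field_simp
  rw [e] at hgeom
  exact (abs_boundary_sub_integral_le_of_isKRContraction hW hWb hsupp hKR hrow hρ hR hμ Λ η hF hD).trans
    (mul_le_mul_of_nonneg_left hgeom (by positivity))

/-- **Two boundary fields, from ANY robust single-link door**: under the hypotheses of
`abs_boundary_sub_integral_le_of_isKRContraction` (no DLR state needed), for every two boundary fields `η, η'`:
`|∫ F dγ^W_Λ(· | η) − ∫ F dγ^W_Λ(· | η')| ≤ 2√N · K · #Δ · max(ρ, ½)^{⌊D / max(1, R)⌋₊}` —
`BoundaryDecay.abs_integral_kernel_sub_integral_kernel_le` with the depth profile. [folklore] -/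
theorem abs_boundary_sub_boundary_le_of_isKRContraction {β ρ R : ℝ}
    {W : Potential (ZdEdge d) (Matrix.specialUnitaryGroup (Fin N) ℂ)} (hW : W.IsAdapted)
    (hWb : ∀ X, ∃ C, ∀ U, |W X U| ≤ C)
    {supp : Finset (ZdEdge d) → Finset (Finset (ZdEdge d))} (hsupp : W.IsSupportedBy supp)
    {C : ZdEdge d → ZdEdge d → ℝ}
    (hKR : IsKRContraction (perturbedYM (d := d) (fundamentalRep (Fin N)) (N * β) W supp) suFrobDist
      (perturbedNbr supp) C)
    (hrow : ∀ x, ∑ y ∈ perturbedNbr supp x, C x y ≤ ρ) (hρ : ρ < 1)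
    (hR : ∀ e, ∀ X ∈ supp {e}, e ∈ X → ∀ y ∈ X, ‖e.1 - y.1‖ ≤ R)
    (Λ : Finset (ZdEdge d)) (η η' : LGConfig d (Matrix.specialUnitaryGroup (Fin N) ℂ))
    {F : LGConfig d (Matrix.specialUnitaryGroup (Fin N) ℂ) → ℝ} {Δ : Finset (ZdEdge d)} {K : ℝ≥0}
    (hF : IsLipschitzCylinder (fundamentalRep (Fin N)) F Δ K) {D : ℝ}
    (hD : ∀ y ∈ Δ, ∀ z, z ∉ Λ → D ≤ ‖y.1 - z.1‖) :
    |(∫ U, F U ∂(perturbedYM (d := d) (fundamentalRep (Fin N)) (N * β) W supp Λ η)) -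
        ∫ U, F U ∂(perturbedYM (d := d) (fundamentalRep (Fin N)) (N * β) W supp Λ η')| ≤
      2 * Real.sqrt N * K * Δ.card * (max ρ (1 / 2)) ^ ⌊D / max 1 R⌋₊ := by
  classical
  haveI : SecondCountableTopology (Matrix (Fin N) (Fin N) ℂ) :=
    inferInstanceAs (SecondCountableTopology (Fin N → Fin N → ℂ))
  haveI : SecondCountableTopology (Matrix.specialUnitaryGroup (Fin N) ℂ) :=
    Topology.IsEmbedding.subtypeVal.secondCountableTopology
  have hγ : IsSpecification (perturbedYM (d := d) (fundamentalRep (Fin N)) (N * β) W supp) :=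
    isSpecification_perturbedYM _ (continuous_fundamentalRep (Fin N)) _ hW hWb hsupp
  have hc'0 : 0 < max ρ (1 / 2) := lt_max_of_lt_right (by norm_num)
  have hc'1 : max ρ (1 / 2) < 1 := max_lt hρ (by norm_num)
  have hrow' : ∀ x ∈ Λ, ∑ y ∈ perturbedNbr supp x, C x y ≤ max ρ (1 / 2) := fun x _ =>
    (hrow x).trans (le_max_left _ _)
  have hR₀0 : 0 < max 1 R := zero_lt_one.trans_le (le_max_left _ _)
  have hRsqrt : (0 : ℝ) ≤ 2 * Real.sqrt N := by positivity
  haveI := hγ.isProbability Λ η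
  haveI := hγ.isProbability Λ η'
  rcases Δ.eq_empty_or_nonempty with hΔ | hΔ
  · have hconst : ∀ U, F U = F 1 := fun U => hF.dependsOn (fun x hx => by simp [hΔ] at hx)
    simp only [hconst, integral_const, smul_eq_mul, probReal_univ, one_mul, sub_self, abs_zero, hΔ,
      Finset.card_empty, Nat.cast_zero, mul_zero, zero_mul, le_refl]
  obtain ⟨ℓ, hℓ0, hℓ1, hℓΔ⟩ := exists_depthProfile hR₀0 (fun x y hy => norm_sub_le_of_mem_perturbedNbr hR x hy) hΔ hD
  have key := BoundaryDecay.abs_integral_kernel_sub_integral_kernel_le hγ hKR (fun _ _ => suFrobDist_nonneg _ _)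
    suFrobDist_le hRsqrt hc'0.le hc'1.le Λ hrow' η η' ℓ hℓ0 hℓ1 hF.measurable hF.dependsOn hF.abs_le
    (hF.isLipBound zero_le_one (fun a b => by rw [one_mul]; exact dist_suEntries_le_suFrobDist a b))
  rw [sum_pow_mul_ite_eq hℓΔ] at key
  refine key.trans (le_of_eq ?_)
  ring

end Summit.Ventures.YMGap.RobustBall

end
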